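import Literature.Geometry.Riemannian.ThreeShrinkerDegenerateDeveloping
import Literature.Geometry.Riemannian.RoundCylinderThree
import HarnessLib

/-!
# Degenerate three-dimensional shrinkers: Cartan's developing map from the round cylinder

Continuation of `ThreeShrinkerDegenerateDeveloping` (degenerate case of Munteanu–Wang 2016,
Thm. 1.2). The model is the round cylinder `C = S²(√2) × ℝ` in its conformal presentation
`(ℝ³ ∖ 0, g_c = 2|y|⁻² δ)` (`RoundCylinderThree.cyl3`), with the explicit inverse of its
exponential map at a point `õ` of the unit sphere off the antipodal ray `{ŷ = −õ}`:
`y ↦ (log|y|, Log_õ(ŷ))`, `ŷ = y/|y|`, `Log_õ` the inverse of `exp^{S²}_õ` on the ball of radius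
`π` (`SphereLocalIsometry.sphereLog`). Given a point `x` of the shrinker `M` (complete, connected,
normalised, `S ≡ 1`, degenerate) with an orthonormal frame `(a₁, a₂, ν)`, `ν` null, and a
`g_round`-orthonormal pair `(ε₀, ε₁)` at `õ`, **Cartan's developing map** is

  `devMap y = exp_x( √2 g(Log_õ ŷ, ε₀) a₁ + √2 g(Log_õ ŷ, ε₁) a₂ + √2 log|y| ν )`

(do Carmo 1992, Ch. 8, Thm. 2.1: `exp_x ∘ ι ∘ exp_õ⁻¹`). Proved here:

* `nE`, `hat`, `Lg`, `LgE` — `y ↦ y/|y|` as a smooth map `ℝ³ ∖ 0 → S²`, its differential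
  (`fderiv_nE_apply`, `norm_sq_fderiv_nE`, `fderiv_nE_self`), and `Log_õ ∘ hat`;
* `roundMetric_mfderiv_sphereExp_Lg` — `|d(exp_õ)_{Log ŷ}(d(Log∘hat) ζ)|²_{S²} = |d(y/|y|) ζ|²`;
* `VE`, `devMap`, `contMDiffAt_devMap`, `mfderiv_devMap_apply` — the map, smooth off the
  antipodal ray, with its differential;
* **`val_mfderiv_devMap_self`, `val_mfderiv_devMap`** — **it is isometric off the antipodal ray**:
  `g(dF ζ, dF ζ') = g_c(ζ, ζ')` (`val_mfderiv_expMap_eq_two_mul_sphere` + the two items above: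
  `2|dŷ(ζ)|² + 2⟨ŷ,ζ⟩²/|y|² = 2|ζ|²/|y|²`);
* `devMap_basePt` — `F(õ) = x`; `mfderiv_devMap_radial` — `dF_y(y) = √2 · d(exp_x)_v(ν)`;
* **`potential_devMap`** — `f ∘ F = (log|y|)²/2 + 1 = f_C` when `x` is a critical point of `f`
  with `f(x) = 1` (`potential_expMap`).

Everything is proved; the new `def`s are concrete maps (no named facts, D-0026).

## References

* O. Munteanu, J. Wang, arXiv:1606.01861, Thm. 1.2 (p. 3). [MunteanuWang2016]
* M. P. do Carmo, *Riemannian Geometry*, Birkhäuser 1992, Ch. 8, Thm. 2.1 and Thm. 4.1 (proof).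
  [doCarmo1992]
* J. M. Lee, *Introduction to Riemannian Manifolds*, 2nd ed., Springer 2018, Thm. 10.14,
  Cor. 12.3. [Lee2018]
-/

noncomputable section

open Bundle Set Function Filter Module Metric
open scoped Manifold ContDiff Topology NNReal RealInnerProductSpace

namespace Literature.Geometry.Riemannian

open Lorentzian Lorentzian.PseudoRiemannianMetric RoundCylinderThree

/-- Shorthand: the round metric of `S² ⊂ ℝ³`. -/
local notation "gS" => roundMetric (n := 2) (EuclideanSpace ℝ (Fin 3))

/-- Shorthand: the model plane of `S²`. -/
local notation "E2" => EuclideanSpace ℝ (Fin 2)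

attribute [local instance] contMDiffCovariantDerivative_roundMetric_one
  contMDiffCovariantDerivative_roundMetric_top

/-! ### `y ↦ y/|y|` on `ℝ³`: calculus -/

section Normalisation

/-- `nE y = y/|y|` (total on `ℝ³`, `0 ↦ 0`). [folklore] -/
def nE (y : E3) : E3 := ‖y‖⁻¹ • y

/-- `|y/|y|| = 1` for `y ≠ 0`. [folklore] -/
theorem norm_nE {y : E3} (hy : y ≠ 0) : ‖nE y‖ = 1 := by
  rw [nE, norm_smul, norm_inv, norm_norm, inv_mul_cancel₀ (norm_ne_zero_iff.2 hy)]

/-- `y/|y|` is smooth off the origin. [folklore] -/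
theorem contDiffAt_nE {y : E3} (hy : y ≠ 0) {n : ℕ∞ω} : ContDiffAt ℝ n nE y :=
  ((contDiffAt_norm ℝ hy).inv (norm_ne_zero_iff.2 hy)).smul contDiffAt_id

/-- `d(|y|⁻¹) = −|y|⁻³ ⟪y, ·⟫`. [folklore] -/
theorem hasFDerivAt_inv_norm {y : E3} (hy : y ≠ 0) :
    HasFDerivAt (fun z : E3 ↦ ‖z‖⁻¹) (-(‖y‖ ^ 3)⁻¹ • innerSL ℝ y) y := by
  have hn : 0 < ‖y‖ := norm_pos_iff.2 hy
  have hn2 : 0 < ‖y‖ ^ 2 := pow_pos hn 2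
  have h1 : HasFDerivAt (fun z : E3 ↦ ‖z‖ ^ 2) (2 • innerSL ℝ y) y :=
    (hasStrictFDerivAt_norm_sq y).hasFDerivAt
  have h2 : HasFDerivAt (fun z : E3 ↦ Real.sqrt (‖z‖ ^ 2)) ((1 / (2 * Real.sqrt (‖y‖ ^ 2))) •
      (2 • innerSL ℝ y)) y := (Real.hasDerivAt_sqrt hn2.ne').comp_hasFDerivAt y h1
  have h3 : HasFDerivAt (fun z : E3 ↦ (Real.sqrt (‖z‖ ^ 2))⁻¹)
      ((-(Real.sqrt (‖y‖ ^ 2) ^ 2)⁻¹) • ((1 / (2 * Real.sqrt (‖y‖ ^ 2))) • (2 • innerSL ℝ y))) y := by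
    have hs : Real.sqrt (‖y‖ ^ 2) ≠ 0 := by rw [Real.sqrt_sq hn.le]; exact hn.ne'
    exact (hasDerivAt_inv hs).comp_hasFDerivAt y h2
  have hfun : (fun z : E3 ↦ (Real.sqrt (‖z‖ ^ 2))⁻¹) = fun z ↦ ‖z‖⁻¹ := by
    funext z; rw [Real.sqrt_sq (norm_nonneg z)]
  rw [hfun, Real.sqrt_sq hn.le] at h3
  refine h3.congr_fderiv ?_
  ext v
  simp only [smul_apply, innerSL_apply_apply, smul_eq_mul, nsmul_eq_mul, Nat.cast_ofNat]
  field_simp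

/-- `d(y/|y|)_y = |y|⁻¹ id − |y|⁻³ ⟪y, ·⟫ y`. [folklore] -/
theorem hasFDerivAt_nE {y : E3} (hy : y ≠ 0) :
    HasFDerivAt nE (‖y‖⁻¹ • ContinuousLinearMap.id ℝ E3 +
      (-(‖y‖ ^ 3)⁻¹ • innerSL ℝ y).smulRight y) y := by
  have h := (hasFDerivAt_inv_norm hy).smul (hasFDerivAt_id y)
  exact h

/-- `d(y/|y|)_y ζ = ζ/|y| − (⟪y,ζ⟫/|y|³) y`. [folklore] -/
theorem fderiv_nE_apply {y : E3} (hy : y ≠ 0) (ζ : E3) :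
    fderiv ℝ nE y ζ = ‖y‖⁻¹ • ζ + (-(⟪y, ζ⟫ / ‖y‖ ^ 3)) • y := by
  rw [(hasFDerivAt_nE hy).fderiv]
  simp only [_root_.add_apply, _root_.smul_apply,
    ContinuousLinearMap.id_apply, ContinuousLinearMap.smulRight_apply, innerSL_apply_apply,
    smul_eq_mul]
  congr 1
  rw [neg_mul, inv_mul_eq_div]

/-- `|d(y/|y|)_y ζ|² = (|ζ|² − ⟪y,ζ⟫²/|y|²)/|y|²` (the tangential part of `ζ`, scaled). [folklore] -/
theorem norm_sq_fderiv_nE {y : E3} (hy : y ≠ 0) (ζ : E3) :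
    ‖fderiv ℝ nE y ζ‖ ^ 2 = (‖ζ‖ ^ 2 - ⟪y, ζ⟫ ^ 2 / ‖y‖ ^ 2) / ‖y‖ ^ 2 := by
  have hn : ‖y‖ ≠ 0 := norm_ne_zero_iff.2 hy
  rw [fderiv_nE_apply hy]
  set c : ℝ := -(⟪y, ζ⟫ / ‖y‖ ^ 3) with hc
  rw [← real_inner_self_eq_norm_sq (‖y‖⁻¹ • ζ + c • y)]
  simp only [inner_add_left, inner_add_right, real_inner_smul_left, real_inner_smul_right]
  rw [real_inner_self_eq_norm_sq ζ, real_inner_self_eq_norm_sq y, real_inner_comm y ζ, hc]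
  field_simp
  ring

/-- `d(y/|y|)_y y = 0` (radial directions are collapsed). [folklore] -/
theorem fderiv_nE_self {y : E3} (hy : y ≠ 0) : fderiv ℝ nE y y = 0 := by
  have hn : ‖y‖ ≠ 0 := norm_ne_zero_iff.2 hy
  rw [fderiv_nE_apply hy, real_inner_self_eq_norm_sq, ← add_smul]
  have : ‖y‖⁻¹ + -(‖y‖ ^ 2 / ‖y‖ ^ 3) = 0 := by field_simp; ring
  rw [this, zero_smul]

/-- Points of `ℝ³ ∖ {0}`, normalised, lie on the unit sphere. [folklore] -/
theorem nE_mem_sphere (y : P3) : nE (y : E3) ∈ sphere (0 : E3) 1 := by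
  rw [mem_sphere_zero_iff_norm, norm_nE (coe_ne_zero y)]

/-- **`hat y = y/|y| ∈ S²`** as a map `ℝ³ ∖ {0} → S²`. [folklore] -/
def hat : P3 → sphere (0 : E3) 1 := Set.codRestrict (fun y : P3 ↦ nE (y : E3)) _ nE_mem_sphere

/-- `hat y = y/|y|` in `ℝ³`. [folklore] -/
theorem coe_hat (y : P3) : (hat y : E3) = nE y := rfl

/-- `y ↦ y/|y|` is smooth on `ℝ³ ∖ {0}` (as an `ℝ³`-valued map). [folklore] -/
theorem contMDiff_nE_val : ContMDiff 𝓘(ℝ, E3) 𝓘(ℝ, E3) ∞ (fun y : P3 ↦ nE (y : E3)) := by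
  have h : ContDiffOn ℝ ∞ nE {y : E3 | y ≠ 0} := fun y hy ↦ (contDiffAt_nE hy).contDiffWithinAt
  exact h.contMDiffOn.comp_contMDiff contMDiff_subtype_val fun y ↦ coe_ne_zero y

/-- **`hat` is smooth.** [folklore] -/
theorem contMDiff_hat : ContMDiff 𝓘(ℝ, E3) (𝓡 2) ∞ hat :=
  contMDiff_nE_val.codRestrict_sphere nE_mem_sphere

/-- **The differential of `hat` read in `ℝ³`**: `dι(d hat_y ζ) = d(y/|y|)_y ζ`. [folklore] -/
theorem mfderiv_coe_hat (y : P3) (ζ : E3) :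
    mfderiv (𝓡 2) 𝓘(ℝ, E3) ((↑) : sphere (0 : E3) 1 → E3) (hat y)
      (mfderiv 𝓘(ℝ, E3) (𝓡 2) hat y ζ) = fderiv ℝ nE y ζ := by
  have h1 : MDifferentiableAt (𝓡 2) 𝓘(ℝ, E3) ((↑) : sphere (0 : E3) 1 → E3) (hat y) :=
    (contMDiff_coe_sphere (m := ∞) (hat y)).mdifferentiableAt (by simp)
  have h2 : MDifferentiableAt 𝓘(ℝ, E3) (𝓡 2) hat y := (contMDiff_hat y).mdifferentiableAt (by simp)
  have hcomp := mfderiv_comp y h1 h2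
  have hfun : ((↑) : sphere (0 : E3) 1 → E3) ∘ hat = fun y : P3 ↦ nE (y : E3) := rfl
  rw [hfun, OpensChart.mfderiv_eq y (fun y : P3 ↦ nE (y : E3)) nE (fun _ ↦ rfl)
    ((contDiffAt_nE (n := 1) (coe_ne_zero y)).differentiableAt one_ne_zero)] at hcomp
  rw [hcomp]
  rfl

/-- `d hat_y(y) = 0`. [folklore] -/
theorem mfderiv_hat_self (y : P3) : mfderiv 𝓘(ℝ, E3) (𝓡 2) hat y (y : E3) = 0 := by
  apply mfderiv_coe_sphere_injective (n := 2) (hat y)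
  rw [mfderiv_coe_hat, fderiv_nE_self (coe_ne_zero y), map_zero]
  rfl

end Normalisation

/-! ### `Log_õ ∘ hat` and the sphere identity -/

section LogHat

variable (o : sphere (0 : E3) 1)

/-- `Lg o y = Log_õ(y/|y|) ∈ T_õS²` (the model plane). [folklore] -/
def Lg (y : P3) : E2 := SphereLocalIsometry.sphereLog E3 2 o (hat y)

open Classical in
/-- A total representative of `Lg o` on `ℝ³` (junk `0` at the origin). [folklore] -/
def LgE (z : E3) : E2 := if h : z ∈ (punctured : Set E3) then Lg o ⟨z, h⟩ else 0

/-- `Lg = LgE` on `ℝ³ ∖ {0}`. [folklore] -/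
theorem Lg_eq_LgE (y : P3) : Lg o y = LgE o y := by
  unfold LgE
  split_ifs with h
  · rfl
  · exact absurd y.2 h

/-- The domain of the developing map: off the antipodal ray `{ŷ = −õ}`. [folklore] -/
def Uo : Set P3 := {y | (hat y : E3) ≠ -(o : E3)}

/-- `Uo` is open. [folklore] -/
theorem isOpen_Uo : IsOpen (Uo o) :=
  isOpen_ne_fun ((contMDiff_coe_sphere.comp contMDiff_hat).continuous) continuous_const

variable {o}

/-- `Lg o` is smooth on `Uo`. [folklore] -/
theorem contMDiffAt_Lg {y : P3} (hy : y ∈ Uo o) : ContMDiffAt 𝓘(ℝ, E3) 𝓘(ℝ, E2) ∞ (Lg o) y :=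
  (SphereLocalIsometry.contMDiffAt_sphereLog hy).comp y (contMDiff_hat y)

/-- `LgE o` is smooth at points of `Uo`. [folklore] -/
theorem contDiffAt_LgE {y : P3} (hy : y ∈ Uo o) : ContDiffAt ℝ ∞ (LgE o) y :=
  (OpensChart.contMDiffAt_iff y (Lg o) (LgE o) (Lg_eq_LgE o)).1 (contMDiffAt_Lg hy)

/-- `LgE o` is differentiable at points of `Uo`. [folklore] -/
theorem differentiableAt_LgE {y : P3} (hy : y ∈ Uo o) : DifferentiableAt ℝ (LgE o) y :=
  (contDiffAt_LgE hy).differentiableAt (by simp)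

/-- `(gS)_õ` as a bilinear form on the model plane (a retyping, for calculus). [folklore] -/
def roundForm (o : sphere (0 : E3) 1) : E2 →L[ℝ] E2 →L[ℝ] ℝ := (gS).val o

/-- Unfolding lemma for `roundForm`. [folklore] -/
theorem roundForm_apply (o : sphere (0 : E3) 1) (v w : E2) : roundForm o v w = (gS).val o v w :=
  rfl

/-- `d(Lg o)_y = d(LgE o)_y`. [folklore] -/
theorem mfderiv_Lg {y : P3} (hy : y ∈ Uo o) :
    mfderiv 𝓘(ℝ, E3) 𝓘(ℝ, E2) (Lg o) y = fderiv ℝ (LgE o) y :=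
  OpensChart.mfderiv_eq y (Lg o) (LgE o) (Lg_eq_LgE o) (differentiableAt_LgE hy)

/-- `exp_õ (Lg o y) = ŷ` on `Uo`. [folklore] -/
theorem sphereExp_Lg {y : P3} (hy : y ∈ Uo o) :
    SphereLocalIsometry.sphereExp E3 2 o (Lg o y) = hat y :=
  SphereLocalIsometry.sphereExp_sphereLog hy

/-- The base point `õ` as a point of `ℝ³ ∖ {0}`. [folklore] -/
def basePt (o : sphere (0 : E3) 1) : P3 := ⟨(o : E3), by
  have h : ‖(o : E3)‖ = 1 := by simp
  intro h0
  have : (o : E3) = 0 := h0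
  rw [this, norm_zero] at h
  exact zero_ne_one h⟩

/-- `(basePt o : ℝ³) = o`. [folklore] -/
@[simp] theorem coe_basePt (o : sphere (0 : E3) 1) : ((basePt o : P3) : E3) = o := rfl

/-- `hat õ = õ`. [folklore] -/
theorem hat_basePt (o : sphere (0 : E3) 1) : hat (basePt o) = o := by
  apply Subtype.ext
  rw [coe_hat, coe_basePt, nE]
  simp

/-- `õ ∈ Uo`. [folklore] -/
theorem basePt_mem_Uo (o : sphere (0 : E3) 1) : basePt o ∈ Uo o := by
  change (hat (basePt o) : E3) ≠ -(o : E3)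
  rw [hat_basePt]
  intro h
  have h1 : ‖(o : E3)‖ = 1 := by simp
  have h2 : (o : E3) = 0 := by
    have : (2 : ℝ) • (o : E3) = 0 := by rw [two_smul]; nth_rewrite 2 [h]; exact add_neg_cancel _
    exact (smul_eq_zero.1 this).resolve_left two_ne_zero
  rw [h2, norm_zero] at h1
  exact zero_ne_one h1

/-- `Lg o õ = 0`. [folklore] -/
theorem Lg_basePt (o : sphere (0 : E3) 1) : Lg o (basePt o) = 0 := by
  rw [Lg, hat_basePt, SphereLocalIsometry.sphereLog_self]

/-- **The sphere identity**: `|d(exp_õ)_{Log ŷ}(d(LgE) ζ)|²_{g_round} = |d(y/|y|)_y ζ|²`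
(`exp_õ ∘ Log ∘ hat = hat` near `y`, read in `ℝ³`). [folklore] -/
theorem roundMetric_mfderiv_sphereExp_Lg {y : P3} (hy : y ∈ Uo o) (ζ : E3) :
    (gS).val (SphereLocalIsometry.sphereExp E3 2 o (Lg o y))
      (mfderiv 𝓘(ℝ, E2) (𝓡 2) (SphereLocalIsometry.sphereExp E3 2 o) (Lg o y)
        (fderiv ℝ (LgE o) y ζ))
      (mfderiv 𝓘(ℝ, E2) (𝓡 2) (SphereLocalIsometry.sphereExp E3 2 o) (Lg o y)
        (fderiv ℝ (LgE o) y ζ)) = ‖fderiv ℝ nE y ζ‖ ^ 2 := by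
  rw [roundMetric_apply_self, norm_tangentSpace_vectorSpace]
  -- `Φ = ι ∘ exp_õ ∘ Lg` agrees with `y ↦ y/|y|` near `y`
  set Φ : P3 → E3 := fun y' ↦ ((SphereLocalIsometry.sphereExp E3 2 o (Lg o y') :
    sphere (0 : E3) 1) : E3) with hΦ
  have hev : Φ =ᶠ[𝓝 y] fun y' : P3 ↦ nE (y' : E3) := by
    filter_upwards [(isOpen_Uo o).mem_nhds hy] with y' hy'
    simp only [hΦ, sphereExp_Lg hy', coe_hat]
  have hdΦ : mfderiv 𝓘(ℝ, E3) 𝓘(ℝ, E3) Φ y = fderiv ℝ nE y := by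
    rw [hev.mfderiv_eq]
    exact OpensChart.mfderiv_eq y (fun y' : P3 ↦ nE (y' : E3)) nE (fun _ ↦ rfl)
      ((contDiffAt_nE (n := 1) (coe_ne_zero y)).differentiableAt one_ne_zero)
  -- chain rule for `Φ = ι ∘ (exp_õ ∘ Lg)`
  have h1 : MDifferentiableAt (𝓡 2) 𝓘(ℝ, E3) ((↑) : sphere (0 : E3) 1 → E3)
      (SphereLocalIsometry.sphereExp E3 2 o (Lg o y)) :=
    (contMDiff_coe_sphere (m := ∞) _).mdifferentiableAt (by simp)
  have h2 : MDifferentiableAt 𝓘(ℝ, E2) (𝓡 2) (SphereLocalIsometry.sphereExp E3 2 o) (Lg o y) :=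
    (SphereLocalIsometry.contMDiff_sphereExp o _).mdifferentiableAt (by simp)
  have h3 : MDifferentiableAt 𝓘(ℝ, E3) 𝓘(ℝ, E2) (Lg o) y :=
    (contMDiffAt_Lg hy).mdifferentiableAt (by simp)
  have h23 := mfderiv_comp y h2 h3
  have h123 := mfderiv_comp y h1 (h2.comp y h3)
  have hΦ' : Φ = ((↑) : sphere (0 : E3) 1 → E3) ∘ (SphereLocalIsometry.sphereExp E3 2 o ∘ Lg o) :=
    rfl
  rw [← hΦ'] at h123
  have hvec : (mfderiv (𝓡 2) 𝓘(ℝ, E3) ((↑) : sphere (0 : E3) 1 → E3)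
      (SphereLocalIsometry.sphereExp E3 2 o (Lg o y))
      (mfderiv 𝓘(ℝ, E2) (𝓡 2) (SphereLocalIsometry.sphereExp E3 2 o) (Lg o y)
        (fderiv ℝ (LgE o) y ζ)) : E3) = fderiv ℝ nE y ζ := by
    rw [← hdΦ, h123, h23, mfderiv_Lg hy]
    rfl
  exact congrArg (fun v : E3 ↦ ‖v‖ ^ 2) hvec

end LogHat

/-! ### The developing map -/

variable {M : Type*} [TopologicalSpace M] [ChartedSpace (EuclideanSpace ℝ (Fin 3)) M]
  [IsManifold (𝓡 3) ∞ M]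
  (g : PseudoRiemannianMetric (𝓡 3) ∞ (EuclideanSpace ℝ (Fin 3)) (TangentSpace (𝓡 3) : M → Type _))
  [g.HasLeviCivita]

namespace DegenerateShrinker

/-- The tangent-vector-valued map behind the developing map, read on `ℝ³`:
`VE z = √2 g(LgE z, ε₀) a₁ + √2 g(LgE z, ε₁) a₂ + √2 L(z) ν` (`L = log|·|` off `0`). [folklore] -/
def VE (o : sphere (0 : E3) 1) (ε₀ ε₁ : TangentSpace (𝓡 2) o) (x : M)
    (a₁ a₂ ν : TangentSpace (𝓡 3) x) (z : E3) : TangentSpace (𝓡 3) x :=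
  (Real.sqrt 2 * (gS).val o (LgE o z) ε₀) • a₁ + (Real.sqrt 2 * (gS).val o (LgE o z) ε₁) • a₂ +
    (Real.sqrt 2 * LE z) • ν

/-- `VE` retyped as an `ℝ³`-valued map (for Fréchet calculus). [folklore] -/
def VE3 (o : sphere (0 : E3) 1) (ε₀ ε₁ : TangentSpace (𝓡 2) o) (x : M)
    (a₁ a₂ ν : TangentSpace (𝓡 3) x) (z : E3) : E3 :=
  VE o ε₀ ε₁ x a₁ a₂ ν z

/-- **Cartan's developing map** `F = exp_x ∘ ι ∘ (exp^C_õ)⁻¹ : C → M` (junk on the antipodal ray):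
`F y = exp_x(√2 g(Log_õ ŷ, ε₀) a₁ + √2 g(Log_õ ŷ, ε₁) a₂ + √2 log|y| ν)`.
[cite: doCarmo1992, Ch. 8, Thm. 2.1] -/
def devMap (o : sphere (0 : E3) 1) (ε₀ ε₁ : TangentSpace (𝓡 2) o) (x : M)
    (a₁ a₂ ν : TangentSpace (𝓡 3) x) (y : P3) : M :=
  expMap g.leviCivita x (VE o ε₀ ε₁ x a₁ a₂ ν y)

section Along

variable [T2Space M] [ConnectedSpace M]
  (hg : ∀ (x : M) (v : TangentSpace (𝓡 3) x), v ≠ 0 → 0 < g.val x v v)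
  {f : M → ℝ} (hf : ContMDiff (𝓡 3) 𝓘(ℝ, ℝ) ∞ f) {lam : ℝ}
  (hsol : ∀ (x : M) (X Y : TangentSpace (𝓡 3) x),
    g.ricci x X Y + g.hessian f x X Y = lam * g.val x X Y)
  (hRic0 : ∀ (x : M) (w : TangentSpace (𝓡 3) x), 0 ≤ g.ricci x w w)
  (hS : ∀ x, 0 < g.scalarCurvature x) {p₀ : M} {w₀ : TangentSpace (𝓡 3) p₀} (hw₀ : w₀ ≠ 0)
  (hnull : g.ricci p₀ w₀ w₀ = 0)
  {κ : (x : M) → TangentSpace (𝓡 3) x → ℝ}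
  (hκ : ∀ (x : M) (w : TangentSpace (𝓡 3) x),
    κ x w = g.val x w w - 2 / g.scalarCurvature x * g.ricci x w w)
  {o : sphere (0 : E3) 1} {ε₀ ε₁ : TangentSpace (𝓡 2) o} {x : M} {a₁ a₂ ν : TangentSpace (𝓡 3) x}

omit [T2Space M] [ConnectedSpace M] in
/-- Unfolding lemma for `devMap`. [folklore] -/
theorem devMap_apply (y : P3) :
    devMap g o ε₀ ε₁ x a₁ a₂ ν y = expMap g.leviCivita x (VE o ε₀ ε₁ x a₁ a₂ ν y) := rfl

omit [ConnectedSpace M] in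
/-- **`F(õ) = x`.** [folklore] -/
theorem devMap_basePt [CovariantDerivative.ContMDiffCovariantDerivative g.leviCivita 1] :
    devMap g o ε₀ ε₁ x a₁ a₂ ν (basePt o) = x := by
  rw [devMap_apply]
  have hV : VE o ε₀ ε₁ x a₁ a₂ ν (basePt o) = 0 := by
    have h1 : LgE o (basePt o : E3) = 0 := by rw [← Lg_eq_LgE, Lg_basePt]
    have h2 : LE (basePt o : E3) = 0 := by
      rw [LE_eq_log (coe_ne_zero _), coe_basePt]; simp
    have h1' : (gS).val o (LgE o (basePt o : E3)) = 0 := by rw [h1]; exact map_zero _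
    rw [VE, h1', h2]
    simp only [_root_.zero_apply, mul_zero, zero_smul, add_zero]
  rw [hV]
  exact expMap_zero (cov := g.leviCivita) x

omit [IsManifold (𝓡 3) ∞ M] [T2Space M] [ConnectedSpace M] in
/-- `VE3 = VE` pointwise. [folklore] -/
theorem VE3_apply (z : E3) : VE3 o ε₀ ε₁ x a₁ a₂ ν z = VE o ε₀ ε₁ x a₁ a₂ ν z := rfl

omit [IsManifold (𝓡 3) ∞ M] [T2Space M] [ConnectedSpace M] in
/-- `VE` is smooth at points of `Uo` (read on `ℝ³`). [folklore] -/
theorem contDiffAt_VE3 {y : P3} (hy : y ∈ Uo o) : ContDiffAt ℝ ∞ (VE3 o ε₀ ε₁ x a₁ a₂ ν) (y : E3) := by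
  set b₁ : E3 := a₁ with hb₁
  set b₂ : E3 := a₂ with hb₂
  set b₃ : E3 := ν with hb₃
  have hL := contDiffAt_LgE hy
  have hc : ∀ ε : E2, ContDiffAt ℝ ∞ (fun z : E3 ↦ roundForm o (LgE o z) ε) (y : E3) := fun ε ↦
    ((roundForm o).contDiff.contDiffAt.comp (y : E3) hL).clm_apply contDiffAt_const
  have h0 := ((contDiffAt_const (c := Real.sqrt 2)).mul (hc ε₀)).smul (contDiffAt_const (c := b₁))
  have h1 := ((contDiffAt_const (c := Real.sqrt 2)).mul (hc ε₁)).smul (contDiffAt_const (c := b₂))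
  have h2 := ((contDiffAt_const (c := Real.sqrt 2)).mul (contDiffAt_LE (n := ∞) (coe_ne_zero y))).smul
    (contDiffAt_const (c := b₃))
  exact (h0.add h1).add h2

omit [ConnectedSpace M] in
/-- **`F` is smooth off the antipodal ray.** [folklore] -/
theorem contMDiffAt_devMap [CovariantDerivative.ContMDiffCovariantDerivative g.leviCivita 1]
    [CovariantDerivative.ContMDiffCovariantDerivative g.leviCivita ∞]
    (hc : IsGeodesicallyComplete g.leviCivita) {y : P3} (hy : y ∈ Uo o) :
    ContMDiffAt 𝓘(ℝ, E3) (𝓡 3) ∞ (devMap g o ε₀ ε₁ x a₁ a₂ ν) y := by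
  have hV : ContMDiffAt 𝓘(ℝ, E3) 𝓘(ℝ, E3) ∞ (fun y : P3 ↦ VE3 o ε₀ ε₁ x a₁ a₂ ν y) y :=
    (OpensChart.contMDiffAt_iff y _ (VE3 o ε₀ ε₁ x a₁ a₂ ν) (fun _ ↦ rfl)).2 (contDiffAt_VE3 hy)
  exact (contMDiff_expMap_infty (I := 𝓡 3) hc x _).comp y hV

omit [IsManifold (𝓡 3) ∞ M] [T2Space M] [ConnectedSpace M] in
/-- **The differential of `VE` at `y ∈ Uo`**: differentiability and
`d(VE)_y ζ = √2 g(λ,ε₀) a₁ + √2 g(λ,ε₁) a₂ + √2 (⟪y,ζ⟫/|y|²) ν`, `λ = d(LgE)_y ζ`. [folklore] -/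
theorem fderiv_VE3 {y : P3} (hy : y ∈ Uo o) :
    DifferentiableAt ℝ (VE3 o ε₀ ε₁ x a₁ a₂ ν) (y : E3) ∧
    ∀ ζ : E3, fderiv ℝ (VE3 o ε₀ ε₁ x a₁ a₂ ν) y ζ =
      (Real.sqrt 2 * (gS).val o (fderiv ℝ (LgE o) y ζ) ε₀) • a₁ +
        (Real.sqrt 2 * (gS).val o (fderiv ℝ (LgE o) y ζ) ε₁) • a₂ +
        (Real.sqrt 2 * (⟪(y : E3), ζ⟫ / ‖(y : E3)‖ ^ 2)) • ν := by
  set b₁ : E3 := a₁ with hb₁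
  set b₂ : E3 := a₂ with hb₂
  set b₃ : E3 := ν with hb₃
  have hL := (differentiableAt_LgE hy).hasFDerivAt
  have hc : ∀ ε : E2, HasFDerivAt (fun z : E3 ↦ Real.sqrt 2 * roundForm o (LgE o z) ε)
      ((Real.sqrt 2 • (roundForm o).flip ε).comp (fderiv ℝ (LgE o) y)) (y : E3) := fun ε ↦ by
    have h : HasFDerivAt (fun z : E3 ↦ (roundForm o).flip ε (LgE o z))
        (((roundForm o).flip ε).comp (fderiv ℝ (LgE o) y)) (y : E3) :=
      ((roundForm o).flip ε).hasFDerivAt.comp (y : E3) hL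
    have h2 := h.const_mul (Real.sqrt 2)
    simp only [ContinuousLinearMap.flip_apply] at h2
    refine h2.congr_fderiv ?_
    ext v
    simp
  have h0 := (hc ε₀).smul_const b₁
  have h1 := (hc ε₁).smul_const b₂
  have h2 := ((hasFDerivAt_LE (coe_ne_zero y)).const_mul (Real.sqrt 2)).smul_const b₃
  have h := ((h0.add h1).add h2).congr_of_eventuallyEq (f₁ := VE3 o ε₀ ε₁ x a₁ a₂ ν)
    (Filter.Eventually.of_forall fun z ↦ rfl)
  refine ⟨h.differentiableAt, fun ζ ↦ ?_⟩
  rw [h.fderiv]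
  simp only [_root_.add_apply, ContinuousLinearMap.smulRight_apply, ContinuousLinearMap.comp_apply,
    _root_.smul_apply, ContinuousLinearMap.flip_apply, innerSL_apply_apply, smul_eq_mul,
    roundForm_apply]
  rw [inv_mul_eq_div]
  rfl

omit [ConnectedSpace M] in
/-- **The differential of the developing map**:
`dF_y ζ = d(exp_x)_{VE y}(√2 g(λ,ε₀) a₁ + √2 g(λ,ε₁) a₂ + √2 (⟪y,ζ⟫/|y|²) ν)`, `λ = d(LgE o)_y ζ`.
[folklore] -/
theorem mfderiv_devMap_apply [CovariantDerivative.ContMDiffCovariantDerivative g.leviCivita 1]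
    [CovariantDerivative.ContMDiffCovariantDerivative g.leviCivita ∞]
    (hc : IsGeodesicallyComplete g.leviCivita) {y : P3} (hy : y ∈ Uo o) (ζ : E3) :
    mfderiv 𝓘(ℝ, E3) (𝓡 3) (devMap g o ε₀ ε₁ x a₁ a₂ ν) y ζ =
      mfderiv 𝓘(ℝ, EuclideanSpace ℝ (Fin 3)) (𝓡 3)
        (fun w : EuclideanSpace ℝ (Fin 3) ↦ expMap g.leviCivita x (show TangentSpace (𝓡 3) x from w))
        (show EuclideanSpace ℝ (Fin 3) from VE o ε₀ ε₁ x a₁ a₂ ν y)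
        ((Real.sqrt 2 * (gS).val o (fderiv ℝ (LgE o) y ζ) ε₀) • a₁ +
          (Real.sqrt 2 * (gS).val o (fderiv ℝ (LgE o) y ζ) ε₁) • a₂ +
          (Real.sqrt 2 * (⟪(y : E3), ζ⟫ / ‖(y : E3)‖ ^ 2)) • ν) := by
  have hE : MDifferentiableAt 𝓘(ℝ, E3) (𝓡 3)
      (fun w : E3 ↦ expMap g.leviCivita x (show TangentSpace (𝓡 3) x from w))
      (VE3 o ε₀ ε₁ x a₁ a₂ ν y) :=
    (contMDiff_expMap_infty (I := 𝓡 3) hc x _).mdifferentiableAt (by simp)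
  obtain ⟨hd, hfd⟩ := fderiv_VE3 (ε₀ := ε₀) (ε₁ := ε₁) (x := x) (a₁ := a₁) (a₂ := a₂) (ν := ν) hy
  have hV : MDifferentiableAt 𝓘(ℝ, E3) 𝓘(ℝ, E3) (fun y : P3 ↦ VE3 o ε₀ ε₁ x a₁ a₂ ν y) y :=
    (OpensChart.mdifferentiableAt_iff y _ (VE3 o ε₀ ε₁ x a₁ a₂ ν) (fun _ ↦ rfl)).2 hd
  have hcomp := mfderiv_comp y hE hV
  have hfun : (fun w : E3 ↦ expMap g.leviCivita x (show TangentSpace (𝓡 3) x from w)) ∘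
      (fun y : P3 ↦ VE3 o ε₀ ε₁ x a₁ a₂ ν y) = devMap g o ε₀ ε₁ x a₁ a₂ ν := rfl
  rw [hfun] at hcomp
  rw [hcomp]
  have hV' : mfderiv 𝓘(ℝ, E3) 𝓘(ℝ, E3) (fun y : P3 ↦ VE3 o ε₀ ε₁ x a₁ a₂ ν y) y ζ =
      (Real.sqrt 2 * (gS).val o (fderiv ℝ (LgE o) y ζ) ε₀) • a₁ +
        (Real.sqrt 2 * (gS).val o (fderiv ℝ (LgE o) y ζ) ε₁) • a₂ +
        (Real.sqrt 2 * (⟪(y : E3), ζ⟫ / ‖(y : E3)‖ ^ 2)) • ν := by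
    rw [OpensChart.mfderiv_eq y _ (VE3 o ε₀ ε₁ x a₁ a₂ ν) (fun _ ↦ rfl) hd]
    exact hfd ζ
  change mfderiv 𝓘(ℝ, E3) (𝓡 3)
    (fun w : E3 ↦ expMap g.leviCivita x (show TangentSpace (𝓡 3) x from w)) (VE3 o ε₀ ε₁ x a₁ a₂ ν y)
    (mfderiv 𝓘(ℝ, E3) 𝓘(ℝ, E3) (fun y : P3 ↦ VE3 o ε₀ ε₁ x a₁ a₂ ν y) y ζ) = _
  rw [hV']
  rfl

include hg hf hsol hRic0 hS hw₀ hnull hκ in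
/-- **The developing map is isometric off the antipodal ray (quadratic form).**
`|dF_y ζ|²_g = g_c(ζ, ζ) = 2|ζ|²/|y|²`: by `val_mfderiv_expMap_eq_two_mul_sphere`,
`|dF ζ|² = 2|d(exp_õ)(dLog dŷ ζ)|² + 2⟨y,ζ⟩²/|y|⁴ = 2|dŷ ζ|² + 2⟨y,ζ⟩²/|y|⁴ = 2|ζ|²/|y|²`.
[cite: doCarmo1992, Ch. 8, Thm. 2.1] [cite: MunteanuWang2016, Thm. 1.2] -/
theorem val_mfderiv_devMap_self (hS1 : ∀ x, g.scalarCurvature x = 1)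
    (hc : IsGeodesicallyComplete g.leviCivita)
    (h11 : g.val x a₁ a₁ = 1) (h22 : g.val x a₂ a₂ = 1) (hνν : g.val x ν ν = 1)
    (h12 : g.val x a₁ a₂ = 0) (h1ν : g.val x a₁ ν = 0) (h2ν : g.val x a₂ ν = 0)
    (hν : g.ricci x ν ν = 0)
    (e00 : (gS).val o ε₀ ε₀ = 1) (e11 : (gS).val o ε₁ ε₁ = 1) (e01 : (gS).val o ε₀ ε₁ = 0)
    {y : P3} (hy : y ∈ Uo o) (ζ : TangentSpace 𝓘(ℝ, E3) y) :
    g.val (devMap g o ε₀ ε₁ x a₁ a₂ ν y) (mfderiv 𝓘(ℝ, E3) (𝓡 3) (devMap g o ε₀ ε₁ x a₁ a₂ ν) y ζ)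
      (mfderiv 𝓘(ℝ, E3) (𝓡 3) (devMap g o ε₀ ε₁ x a₁ a₂ ν) y ζ) = cyl3.val y ζ ζ := by
  haveI := contMDiffCovariantDerivative_leviCivita_one g
  haveI := contMDiffCovariantDerivative_leviCivita_infty g le_rfl
  have hy0 := coe_ne_zero y
  have hn : ‖(y : E3)‖ ≠ 0 := (norm_pos y).ne'
  rw [mfderiv_devMap_apply g hc hy ζ, devMap_apply]
  have hV : VE o ε₀ ε₁ x a₁ a₂ ν y =
      (Real.sqrt 2 * (gS).val o (Lg o y) ε₀) • a₁ + (Real.sqrt 2 * (gS).val o (Lg o y) ε₁) • a₂ +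
        (Real.sqrt 2 * LE (y : E3)) • ν := by
    rw [VE, ← Lg_eq_LgE]
  rw [hV, val_mfderiv_expMap_eq_two_mul_sphere g hg hf hsol hRic0 hS hw₀ hnull hκ hS1 hc h11 h22 hνν
    h12 h1ν h2ν hν e00 e11 e01 (Lg o y) (fderiv ℝ (LgE o) y ζ) (LE (y : E3))
    (⟪(y : E3), ζ⟫ / ‖(y : E3)‖ ^ 2), roundMetric_mfderiv_sphereExp_Lg hy ζ,
    norm_sq_fderiv_nE hy0, cyl3_apply, real_inner_self_eq_norm_sq]
  field_simp
  ring

include hg hf hsol hRic0 hS hw₀ hnull hκ in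
/-- **The developing map is isometric off the antipodal ray**: `g(dF ζ, dF ζ') = g_c(ζ, ζ')`
(polarisation of `val_mfderiv_devMap_self`). [cite: doCarmo1992, Ch. 8, Thm. 2.1]
[cite: MunteanuWang2016, Thm. 1.2] -/
theorem val_mfderiv_devMap (hS1 : ∀ x, g.scalarCurvature x = 1)
    (hc : IsGeodesicallyComplete g.leviCivita)
    (h11 : g.val x a₁ a₁ = 1) (h22 : g.val x a₂ a₂ = 1) (hνν : g.val x ν ν = 1)
    (h12 : g.val x a₁ a₂ = 0) (h1ν : g.val x a₁ ν = 0) (h2ν : g.val x a₂ ν = 0)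
    (hν : g.ricci x ν ν = 0)
    (e00 : (gS).val o ε₀ ε₀ = 1) (e11 : (gS).val o ε₁ ε₁ = 1) (e01 : (gS).val o ε₀ ε₁ = 0)
    {y : P3} (hy : y ∈ Uo o) (ζ ζ' : TangentSpace 𝓘(ℝ, E3) y) :
    g.val (devMap g o ε₀ ε₁ x a₁ a₂ ν y) (mfderiv 𝓘(ℝ, E3) (𝓡 3) (devMap g o ε₀ ε₁ x a₁ a₂ ν) y ζ)
      (mfderiv 𝓘(ℝ, E3) (𝓡 3) (devMap g o ε₀ ε₁ x a₁ a₂ ν) y ζ') = cyl3.val y ζ ζ' := by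
  have Q := fun ξ : TangentSpace 𝓘(ℝ, E3) y ↦ val_mfderiv_devMap_self g hg hf hsol hRic0 hS hw₀ hnull
    hκ hS1 hc h11 h22 hνν h12 h1ν h2ν hν e00 e11 e01 hy ξ
  have h1 := Q (ζ + ζ')
  have h2 := Q ζ
  have h3 := Q ζ'
  rw [(mfderiv 𝓘(ℝ, E3) (𝓡 3) (devMap g o ε₀ ε₁ x a₁ a₂ ν) y).map_add ζ ζ'] at h1
  simp only [map_add, _root_.add_apply] at h1
  have hs1 : g.val (devMap g o ε₀ ε₁ x a₁ a₂ ν y)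
      (mfderiv 𝓘(ℝ, E3) (𝓡 3) (devMap g o ε₀ ε₁ x a₁ a₂ ν) y ζ')
      (mfderiv 𝓘(ℝ, E3) (𝓡 3) (devMap g o ε₀ ε₁ x a₁ a₂ ν) y ζ) =
      g.val (devMap g o ε₀ ε₁ x a₁ a₂ ν y)
      (mfderiv 𝓘(ℝ, E3) (𝓡 3) (devMap g o ε₀ ε₁ x a₁ a₂ ν) y ζ)
      (mfderiv 𝓘(ℝ, E3) (𝓡 3) (devMap g o ε₀ ε₁ x a₁ a₂ ν) y ζ') := g.symm _ _ _
  have hs2 : cyl3.val y ζ' ζ = cyl3.val y ζ ζ' := cyl3.symm y _ _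
  linarith

omit [ConnectedSpace M] in
/-- **`dF_y(y) = √2 d(exp_x)_{VE y}(ν)`**: the radial direction is developed onto the null line
(`d(Log∘hat)_y(y) = 0`, `dL_y(y) = 1`). [folklore] -/
theorem mfderiv_devMap_radial [CovariantDerivative.ContMDiffCovariantDerivative g.leviCivita 1]
    [CovariantDerivative.ContMDiffCovariantDerivative g.leviCivita ∞]
    (hc : IsGeodesicallyComplete g.leviCivita) {y : P3} (hy : y ∈ Uo o) :
    mfderiv 𝓘(ℝ, E3) (𝓡 3) (devMap g o ε₀ ε₁ x a₁ a₂ ν) y (y : E3) =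
      mfderiv 𝓘(ℝ, EuclideanSpace ℝ (Fin 3)) (𝓡 3)
        (fun w : EuclideanSpace ℝ (Fin 3) ↦ expMap g.leviCivita x (show TangentSpace (𝓡 3) x from w))
        (show EuclideanSpace ℝ (Fin 3) from VE o ε₀ ε₁ x a₁ a₂ ν y) (Real.sqrt 2 • ν) := by
  have hn : ‖(y : E3)‖ ≠ 0 := (norm_pos y).ne'
  have hrad : fderiv ℝ (LgE o) y (y : E3) = 0 := by
    rw [← mfderiv_Lg hy]
    have h3 : MDifferentiableAt 𝓘(ℝ, E3) 𝓘(ℝ, E2) (Lg o) y :=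
      (contMDiffAt_Lg hy).mdifferentiableAt (by simp)
    have hlog : MDifferentiableAt (𝓡 2) 𝓘(ℝ, E2) (SphereLocalIsometry.sphereLog E3 2 o) (hat y) :=
      (SphereLocalIsometry.contMDiffAt_sphereLog hy).mdifferentiableAt (by simp)
    have hhat : MDifferentiableAt 𝓘(ℝ, E3) (𝓡 2) hat y := (contMDiff_hat y).mdifferentiableAt (by simp)
    have hcomp := mfderiv_comp y hlog hhat
    have hfun : SphereLocalIsometry.sphereLog E3 2 o ∘ hat = Lg o := rfl
    rw [hfun] at hcomp
    rw [hcomp]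
    change mfderiv (𝓡 2) 𝓘(ℝ, E2) (SphereLocalIsometry.sphereLog E3 2 o) (hat y)
      (mfderiv 𝓘(ℝ, E3) (𝓡 2) hat y (y : E3)) = 0
    rw [mfderiv_hat_self, map_zero]
  have h0 : (gS).val o (fderiv ℝ (LgE o) y (y : E3)) = 0 := by rw [hrad]; exact map_zero _
  rw [mfderiv_devMap_apply g hc hy, h0, _root_.zero_apply, _root_.zero_apply, mul_zero,
    zero_smul, zero_smul, zero_add, zero_add, real_inner_self_eq_norm_sq, div_self (pow_ne_zero 2 hn),
    mul_one]

include hg hf hsol hRic0 hS hw₀ hnull hκ in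
/-- **`f ∘ F = f_C`**: from a critical point `x` of `f` with `f(x) = 1`,
`f(F y) = 1 + (√2 log|y|)²/4 = (log|y|)²/2 + 1 = f_C(y)` (`potential_expMap`, `κ(VE y) = 2 log²|y|`).
[cite: MunteanuWang2016, Thm. 1.2] -/
theorem potential_devMap (hlam : lam = 1 / 2) (hS1 : ∀ x, g.scalarCurvature x = 1)
    (hc : IsGeodesicallyComplete g.leviCivita) (hfx : f x = 1) (hdf : mvfderiv (𝓡 3) f x = 0)
    (hνν : g.val x ν ν = 1) (h1ν : g.val x a₁ ν = 0) (h2ν : g.val x a₂ ν = 0)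
    (hν : g.ricci x ν ν = 0) (y : P3) :
    f (devMap g o ε₀ ε₁ x a₁ a₂ ν y) = fP y := by
  rw [devMap_apply, potential_expMap g hg hf hsol hRic0 hS hw₀ hnull hκ hlam hS1 hc hfx hdf, VE]
  have huν : g.val x ((Real.sqrt 2 * (gS).val o (LgE o y) ε₀) • a₁ +
      (Real.sqrt 2 * (gS).val o (LgE o y) ε₁) • a₂) ν = 0 := by
    simp only [map_add, map_smul, _root_.add_apply, FunLike.coe_smul, Pi.smul_apply, smul_eq_mul,
      h1ν, h2ν, mul_zero, add_zero]
  have h := kappa_smul_add_smul g hg hf hsol hRic0 hS hw₀ hnull hκ hνν huν hν 1 (Real.sqrt 2 * LE (y : E3))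
  rw [one_smul] at h
  rw [h, fP_eq, fE, mul_pow, Real.sq_sqrt (by norm_num : (0 : ℝ) ≤ 2)]
  ring

end Along

end DegenerateShrinker

end Literature.Geometry.Riemannian

end
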